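import Literature.NumberTheory.GaloisRepresentations.RayClassGroupFinite
import Literature.NumberTheory.GaloisRepresentations.FrobeniusDensityTheorem
import Literature.Barriers.RiemannHypothesis.EpsteinZetaRealZerosDHClassDensity
import HarnessLib

/-!
# Primes in narrow ray classes (Landau 1918, Hecke 1917): every class `mod 𝔪` has Dirichlet
# density `1/h_𝔪`, hence contains infinitely many primes of degree one

Topic `Literature/NumberTheory/LFunctions`; namespace `Literature.NumberTheory.LFunctions`.
Everything in this file is PROVED (no `sorry`, no named fact); the only definition is the datum
`primeRayClass h𝔪 : 𝔭 ↦ [𝔭] ∈ Cl_K^𝔪` (the narrow ray class of a prime `𝔭 ∤ 𝔪`, junk value `1`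
at `𝔭 ∣ 𝔪`) feeding the tree's abelian density vocabulary (`AbelianFrobeniusDensity.lean`).

**Theorem (Landau 1918, §1 Satz; Hecke 1917; Neukirch, *Algebraic Number Theory*, VII (13.2)
with VI (1.9)).** *Let `K` be a number field, `𝔪 ≠ 0` an integral ideal and `h_𝔪` the order of
the (narrow) ray class group `Cl_K^𝔪 = J_K^𝔪/P_K^𝔪`. For every class `𝔎 ∈ Cl_K^𝔪` the set of
prime ideals `𝔭 ∈ 𝔎` has Dirichlet density `1/h_𝔪`; in particular every narrow ray class
`mod 𝔪` contains infinitely many prime ideals of (absolute) degree one.* Landau (loc. cit.)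
proves the sharper prime ideal theorem for classes; the density statement is what his §1
deduces first from `L(1, χ) ≠ 0` for the non-principal characters of `Cl_K^𝔪` ("generalized
theorem about the existence of prime ideals in arithmetic progressions", Cassels 1964, p. 70,
refs. [3]–[5] = Hasse's Bericht, Hecke 1917, Landau 1918).

* `primeRayClass h𝔪` and its algebra: `artinSymbol_primeRayClass` (the multiplicative extension
  of `𝔭 ↦ [𝔭]` to an integral ideal prime to `𝔪` is its class `integralRayClass`),
  `artinKillsRay_primeRayClass` (it kills the ray `P_K^𝔪`), `primeRayClass_generate` (the prime
  classes generate `Cl_K^𝔪`: every class contains an integral ideal prime to `𝔪`,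
  `integralRayClass_surjective`, which factors into primes `∤ 𝔪`).
* `hasStrongDirichletDensity_rayClassFiber` — **every `τ ∈ Cl_K^𝔪` has strong Dirichlet density
  `1/h_𝔪`**: `∑_{deg 𝔭 = 1, 𝔭 ∤ 𝔪, [𝔭] = τ} N𝔭^{-s} + (1/h_𝔪) log (s − 1)` converges as `s → 1⁺`.
  Proof = Landau's: orthogonality `h_𝔪 · #{[𝔭] = τ, N𝔭 = p} = ∑_χ χ(τ)⁻¹ F_χ(p)`
  (`AbelianDensity.card_mul_primeNormCount`), the pole of `ζ_K` for `χ = χ₀`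
  (`AbelianDensity.hasStrongDirichletDensity_not_le`) and, for `χ ≠ χ₀`, the CONVERGENCE of
  `∑_{𝔭 ∤ 𝔪} χ([𝔭]) N𝔭^{-s}` at `s = 1` — Hecke–Landau `L(1, χ) ≠ 0` for non-principal ray class
  characters, in the tree as `DHEpstein.tendsto_primeTerm_of_isRayClassCharacter` (from
  `exists_entire_eq_rayClassLSeries_and_apply_one_ne_zero`).
* `hasStrongDirichletDensity_rayClassRel` — the same in the tree's `RayClassRel` language: for a
  nonzero integral ideal `𝔟` prime to `𝔪`, the primes `𝔭 ∤ 𝔪` with `RayClassRel 𝔪 𝔟 𝔭`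
  (`𝔭 = (b/c) 𝔟`, `b ≡ c mod 𝔪`, `b/c ≫ 0`) have strong Dirichlet density `1/h_𝔪`.
* `infinite_setOf_rayClassRel_and_prime_absNorm` — **infinitely many primes OF DEGREE ONE
  (`N𝔭` a rational prime) in every narrow ray class** (the form used by Cassels 1964, p. 70:
  "choose `δ` in its congruence class with `(𝔓₁⋯𝔓_T𝔔₁⋯𝔔_I)⁻¹δ` a first-degree prime ideal"),
  via the tree's `HasStrongDirichletDensity.infinite_setOf_prime_absNorm`
  (`FrobeniusDensityTheorem.lean`: a set of positive strong density contains infinitely many primes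
  of prime norm — the density only counts those).

## References

* E. Landau, *Über Ideale und Primideale in Idealklassen*, Math. Z. 2 (1918), 52–154, §1.
  [Landau1918Idealklassen]
* E. Hecke, *Über die L-Funktionen und den Dirichletschen Primzahlsatz für einen beliebigen
  Zahlkörper*, Nachr. Ges. Wiss. Göttingen (1917), 299–318. [Hecke1917]
* J. Neukirch, *Algebraic Number Theory* (1999), Ch. VI §1 (1.7)–(1.9); Ch. VII §13, (13.2).
  [NeukirchANT1999]
* J. W. S. Cassels, *Arithmetic on curves of genus 1. VI*, J. reine angew. Math. 214/215 (1964),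
  65–70, p. 70. [Cassels1964ArithmeticVI]
-/

noncomputable section

open Filter Topology Complex NumberField IsDedekindDomain IsDedekindDomain.HeightOneSpectrum
open Literature.NumberTheory.LFunctions.AbelianDensity
open Literature.NumberTheory.GaloisRepresentations
open scoped nonZeroDivisors Classical

namespace Literature.NumberTheory.LFunctions

variable {K : Type*} [Field K] [NumberField K] {𝔪 : Ideal (𝓞 K)}

/-! ### The datum `𝔭 ↦ [𝔭] ∈ Cl_K^𝔪` -/

variable (𝔪) in
/-- **The narrow ray class `[𝔭] ∈ Cl_K^𝔪` of a prime `𝔭 ∤ 𝔪`** (`integralRayClass` of the tree),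
extended by the junk value `1` to the finitely many `𝔭 ∣ 𝔪`: the datum whose fibres are the
narrow ray classes of primes. Ref: Neukirch, *Algebraic Number Theory*, Ch. VI §1 Def. (1.7).
[cite: NeukirchANT1999, Ch. VI §1 Def. (1.7)] -/
def primeRayClass (h𝔪 : 𝔪 ≠ ⊥) (v : HeightOneSpectrum (𝓞 K)) : RayClassGroup 𝔪 :=
  if hv : 𝔪 ≤ v.asIdeal then 1
  else integralRayClass 𝔪 h𝔪 ⟨v.asIdeal, v.ne_bot, isCoprime_asIdeal_of_not_le h𝔪 hv⟩

/-- `[𝔭]` for `𝔭 ∤ 𝔪` is the class of the integral ideal `𝔭`. [folklore] -/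
theorem primeRayClass_of_not_le (h𝔪 : 𝔪 ≠ ⊥) {v : HeightOneSpectrum (𝓞 K)} (hv : ¬ 𝔪 ≤ v.asIdeal)
    (h : v.asIdeal ≠ ⊥ ∧ IsCoprime v.asIdeal 𝔪) :
    primeRayClass 𝔪 h𝔪 v = integralRayClass 𝔪 h𝔪 ⟨v.asIdeal, h⟩ := by
  rw [primeRayClass, dif_neg hv]

/-- The junk value at `𝔭 ∣ 𝔪`. [folklore] -/
theorem primeRayClass_of_le (h𝔪 : 𝔪 ≠ ⊥) {v : HeightOneSpectrum (𝓞 K)} (hv : 𝔪 ≤ v.asIdeal) :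
    primeRayClass 𝔪 h𝔪 v = 1 := by
  rw [primeRayClass, dif_pos hv]

/-- The class of an integral ideal depends only on the ideal (not on the coprimality proofs). [folklore] -/
theorem integralRayClass_congr (h𝔪 : 𝔪 ≠ ⊥) {𝔞 𝔟 : CoprimeIdeal 𝔪} (h : 𝔞.1 = 𝔟.1) :
    integralRayClass 𝔪 h𝔪 𝔞 = integralRayClass 𝔪 h𝔪 𝔟 := by
  rw [Subtype.ext h]

/-- **The class map is multiplicative on integral ideals prime to `𝔪`.** [folklore] -/
theorem integralRayClass_mul (h𝔪 : 𝔪 ≠ ⊥) (𝔞 𝔟 : CoprimeIdeal 𝔪)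
    (h : 𝔞.1 * 𝔟.1 ≠ ⊥ ∧ IsCoprime (𝔞.1 * 𝔟.1) 𝔪) :
    integralRayClass 𝔪 h𝔪 ⟨𝔞.1 * 𝔟.1, h⟩ = integralRayClass 𝔪 h𝔪 𝔞 * integralRayClass 𝔪 h𝔪 𝔟 := by
  unfold integralRayClass
  rw [← QuotientGroup.mk_mul]
  congr 1
  apply Subtype.ext
  rw [Subgroup.coe_mul]
  apply Units.ext
  simp only [Units.val_mk0, Units.val_mul, FractionalIdeal.coeIdeal_mul]

/-- The class of the unit ideal is `1`. [folklore] -/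
theorem integralRayClass_top (h𝔪 : 𝔪 ≠ ⊥) (h : (⊤ : Ideal (𝓞 K)) ≠ ⊥ ∧ IsCoprime (⊤ : Ideal (𝓞 K)) 𝔪) :
    integralRayClass 𝔪 h𝔪 ⟨⊤, h⟩ = 1 := by
  unfold integralRayClass
  rw [← QuotientGroup.mk_one]
  congr 1
  apply Subtype.ext
  rw [Subgroup.coe_one]
  apply Units.ext
  simp only [Units.val_mk0, Units.val_one, FractionalIdeal.coeIdeal_top]

/-- The Artin symbol of the unit ideal is trivial (empty product). [folklore] -/
theorem artinSymbol_top {G : Type*} [CommGroup G] (f : HeightOneSpectrum (𝓞 K) → G) :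
    artinSymbol f (⊤ : Ideal (𝓞 K)) = 1 := by
  have h := artinSymbol_finsuppProd f (0 : HeightOneSpectrum (𝓞 K) →₀ ℕ)
  simpa only [Finsupp.prod_zero_index, Ideal.one_eq_top] using h

/-- **The multiplicative extension of `𝔭 ↦ [𝔭]` to a nonzero integral ideal prime to `𝔪` is its
narrow ray class** (unique factorisation into primes `∤ 𝔪`). [cite: NeukirchANT1999, Ch. VI §1 Prop. (1.9)] -/
theorem artinSymbol_primeRayClass (h𝔪 : 𝔪 ≠ ⊥) {I : Ideal (𝓞 K)} (h : I ≠ ⊥ ∧ IsCoprime I 𝔪) :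
    artinSymbol (primeRayClass 𝔪 h𝔪) I = integralRayClass 𝔪 h𝔪 ⟨I, h⟩ := by
  induction I using UniqueFactorizationMonoid.induction_on_prime with
  | h₁ => exact absurd (Submodule.zero_eq_bot) h.1
  | h₂ I hu =>
    obtain rfl : I = ⊤ := Ideal.isUnit_iff.mp hu
    rw [artinSymbol_top, integralRayClass_top]
  | h₃ J p hJ0 hp ih =>
    have hp0 : p ≠ ⊥ := hp.ne_zero
    have hpP : p.IsPrime := Ideal.isPrime_of_prime hp
    have hJc : IsCoprime J 𝔪 := IsCoprime.of_mul_left_right h.2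
    have hpc : IsCoprime p 𝔪 := IsCoprime.of_mul_left_left h.2
    set v : HeightOneSpectrum (𝓞 K) := ⟨p, hpP, hp0⟩ with hvdef
    have hv : ¬ 𝔪 ≤ v.asIdeal := fun hle =>
      (isCoprime_iff_forall_not_le h𝔪).mp hpc v hle le_rfl
    have h1 : artinSymbol (primeRayClass 𝔪 h𝔪) p = integralRayClass 𝔪 h𝔪 ⟨p, hp0, hpc⟩ := by
      have h2 := artinSymbol_asIdeal (primeRayClass 𝔪 h𝔪) v
      rw [primeRayClass_of_not_le h𝔪 hv ⟨v.ne_bot, isCoprime_asIdeal_of_not_le h𝔪 hv⟩] at h2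
      exact h2
    rw [artinSymbol_mul _ hp0 hJ0, h1, ih ⟨hJ0, hJc⟩]
    exact (integralRayClass_mul h𝔪 ⟨p, hp0, hpc⟩ ⟨J, hJ0, hJc⟩ h).symm

/-- **The datum `𝔭 ↦ [𝔭]` kills the ray `P_K^𝔪`**: for nonzero integers `b ≡ c mod 𝔪`, `c` prime to
`𝔪`, `b/c` totally positive, the ideals `(b)` and `(c)` have the same narrow ray class
(`RayClassRel` with the witnesses `(b, c)` themselves). [cite: NeukirchANT1999, Ch. VI §1 Prop. (1.9)] -/
theorem artinKillsRay_primeRayClass (h𝔪 : 𝔪 ≠ ⊥) : ArtinKillsRay 𝔪 (primeRayClass 𝔪 h𝔪) := by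
  intro b c hb hc hcop hbc hpos
  have hb' : Ideal.span {b} ≠ ⊥ := by rwa [Ne, Ideal.span_singleton_eq_bot]
  have hc' : Ideal.span {c} ≠ ⊥ := by rwa [Ne, Ideal.span_singleton_eq_bot]
  have hbcop : IsCoprime (Ideal.span {b}) 𝔪 := isCoprime_span_of_sub_mem hcop hbc
  rw [artinSymbol_primeRayClass h𝔪 ⟨hb', hbcop⟩, artinSymbol_primeRayClass h𝔪 ⟨hc', hcop⟩,
    integralRayClass_eq_iff h𝔪 ⟨Ideal.span {c}, hc', hcop⟩ ⟨Ideal.span {b}, hb', hbcop⟩]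
  have hrel : RayClassRel 𝔪 (Ideal.span {c}) (Ideal.span {b}) := ⟨b, c, hb, hc, hcop, hbc, hpos, mul_comm _ _⟩
  exact hrel.symm

/-- **The prime classes `[𝔭]`, `𝔭 ∤ 𝔪`, generate `Cl_K^𝔪`**: every class contains an integral ideal
prime to `𝔪` (`integralRayClass_surjective`, Neukirch VI §1 Ex. 11), whose class is the product of
the classes of its prime factors, all `∤ 𝔪`. [cite: NeukirchANT1999, Ch. VI §1 Prop. (1.9) (proof)] -/
theorem primeRayClass_generate (h𝔪 : 𝔪 ≠ ⊥) (H : Subgroup (RayClassGroup 𝔪))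
    (hH : ∀ v : HeightOneSpectrum (𝓞 K), ¬ 𝔪 ≤ v.asIdeal → primeRayClass 𝔪 h𝔪 v ∈ H) : H = ⊤ := by
  rw [eq_top_iff]
  intro g _
  obtain ⟨⟨I, hI⟩, rfl⟩ := integralRayClass_surjective h𝔪 g
  have hall : ∀ v : HeightOneSpectrum (𝓞 K), primeRayClass 𝔪 h𝔪 v ∈ H := fun v ↦ by
    by_cases hv : 𝔪 ≤ v.asIdeal
    · rw [primeRayClass_of_le h𝔪 hv]; exact H.one_mem
    · exact hH v hv
  rw [← artinSymbol_primeRayClass h𝔪 hI, artinSymbol]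
  exact finprod_induction (· ∈ H) H.one_mem (fun _ _ hx hy ↦ H.mul_mem hx hy)
    fun v ↦ H.pow_mem (hall v) _

/-- A non-trivial character of `Cl_K^𝔪` is `≠ 1` at the class of some prime `𝔭 ∤ 𝔪` (the prime
classes generate), i.e. `𝔭 ↦ χ([𝔭])` is a NON-PRINCIPAL ray class character. [folklore] -/
theorem exists_charFun_primeRayClass_ne_one (h𝔪 : 𝔪 ≠ ⊥)
    (χ : AddChar (Additive (RayClassGroup 𝔪)) ℂ) (hχ : χ ≠ 0) :
    ∃ v : HeightOneSpectrum (𝓞 K), ¬ 𝔪 ≤ v.asIdeal ∧ χ (Additive.ofMul (primeRayClass 𝔪 h𝔪 v)) ≠ 1 := by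
  by_contra hall
  push Not at hall
  set H : Subgroup (RayClassGroup 𝔪) := (toMulHom (G := RayClassGroup 𝔪) χ).toHomUnits.ker with hH
  have hmem : ∀ g : RayClassGroup 𝔪, g ∈ H ↔ χ (Additive.ofMul g) = 1 := fun g ↦ by
    rw [hH, MonoidHom.mem_ker, Units.ext_iff, MonoidHom.coe_toHomUnits, toMulHom_apply, Units.val_one]
  have hHtop : H = ⊤ := primeRayClass_generate h𝔪 H fun v hv ↦
    (hmem (primeRayClass 𝔪 h𝔪 v)).mpr (hall v hv)
  apply hχ
  rw [AddChar.eq_zero_iff]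
  intro x
  have hx : Additive.toMul x ∈ H := by rw [hHtop]; exact Subgroup.mem_top _
  rw [hmem] at hx
  simpa only [ofMul_toMul] using hx

/-! ### Equidistribution of an abelian Frobenius datum, unconditionally -/

section Generic

variable {G : Type*} [CommGroup G] [Finite G] {f : HeightOneSpectrum (𝓞 K) → G}

/-- `D_χ(s) = ∑_{deg 𝔭 = 1, 𝔭 ∤ 𝔪} χ(f 𝔭) N𝔭^{-s}` converges as `s → 1⁺` for every character `χ` of
`G` for which `𝔭 ↦ χ(f 𝔭)` is a NON-PRINCIPAL ray class character `mod 𝔪` — Hecke–Landau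
`L(1, χ) ≠ 0` (Landau 1918, §1: "`L(s, χ)` … für `s = 1` … von Null verschieden"), in the tree's form
`DHEpstein.tendsto_primeTerm_of_isRayClassCharacter`. [cite: Landau1918Idealklassen, §1] -/
theorem tendsto_charPrimeSum_of_artinKillsRay (h𝔪 : 𝔪 ≠ ⊥) (hray : ArtinKillsRay 𝔪 f)
    (χ : AddChar (Additive G) ℂ)
    (hnt : ∃ v : HeightOneSpectrum (𝓞 K), ¬ 𝔪 ≤ v.asIdeal ∧ χ (Additive.ofMul (f v)) ≠ 1) :
    ∃ d : ℂ, Tendsto (fun s : ℝ ↦ ∑' v, primeTerm (charCoeff 𝔪 f χ) s v) (𝓝[>] 1) (𝓝 d) :=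
  Literature.Barriers.RiemannHypothesis.DHEpstein.tendsto_primeTerm_of_isRayClassCharacter h𝔪
    (isRayClassCharacter_toMulHom hray χ) hnt

/-- `D_1(s) + log (s − 1)` converges as `s → 1⁺` for the trivial character: `D_1(s)` is the
degree-one prime sum over `𝔭 ∤ 𝔪`, `= log ζ_K(s) + O(1)` (pole of `ζ_K`; the primes `𝔭 ∣ 𝔪` are
finitely many, `AbelianDensity.hasStrongDirichletDensity_not_le`). [cite: Landau1918Idealklassen, §1] -/
theorem tendsto_charPrimeSum_zero_add_log (h𝔪 : 𝔪 ≠ ⊥) (f : HeightOneSpectrum (𝓞 K) → G) :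
    ∃ L₀ : ℝ, Tendsto (fun s : ℝ ↦
      (∑' v, primeTerm (charCoeff 𝔪 f 0) s v) + (Real.log (s - 1) : ℂ)) (𝓝[>] 1) (𝓝 (L₀ : ℂ)) := by
  obtain ⟨L₀, hL₀⟩ := id (hasStrongDirichletDensity_not_le (K := K) (𝔪 := 𝔪) h𝔪)
  refine ⟨L₀, ((Complex.continuous_ofReal.tendsto L₀).comp hL₀).congr' ?_⟩
  filter_upwards [self_mem_nhdsWithin] with s hs
  have ha : ∀ v, ‖charCoeff 𝔪 f 0 v‖ ≤ 1 := fun v ↦ norm_charCoeff_le 𝔪 f 0 v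
  have hDsum := hasSum_primeTerm_fiberwise ha hs
  have hcntB : ∀ p : Nat.Primes,
      |(primeNormCount K {v | ¬ 𝔪 ≤ v.asIdeal} p : ℝ)| ≤ (2 : ℝ) ^ Module.finrank ℚ K :=
    fun p ↦ abs_primeNormCount_le _ p
  have h1 : HasSum (fun p : Nat.Primes ↦
      (primeNormCount K {v | ¬ 𝔪 ≤ v.asIdeal} p : ℝ) * ((p : ℕ) : ℝ) ^ (-s))
      (primeSeries (fun p ↦ (primeNormCount K {v | ¬ 𝔪 ≤ v.asIdeal} p : ℝ)) s) := by
    rw [primeSeries]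
    exact (summable_primes_mul_rpow_of_bounded
      (f := fun n ↦ (primeNormCount K {v | ¬ 𝔪 ≤ v.asIdeal} n : ℝ)) hcntB hs).hasSum
  have h2 := Complex.hasSum_ofReal.mpr h1
  have hc0 : ∀ p : ℕ, (∑ v ∈ primesOfNorm K p, charCoeff 𝔪 f 0 v) =
      (primeNormCount K {v | ¬ 𝔪 ≤ v.asIdeal} p : ℂ) := fun p ↦ charCount_zero p
  have hD0 : (∑' v, primeTerm (charCoeff 𝔪 f 0) s v) =
      ((primeSeries (fun p ↦ (primeNormCount K {v | ¬ 𝔪 ≤ v.asIdeal} p : ℝ)) s : ℝ) : ℂ) := by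
    refine hDsum.unique (h2.congr_fun fun p ↦ ?_)
    rw [hc0 p]
    push_cast
    ring
  simp only [Function.comp_apply]
  rw [hD0]
  push_cast
  ring

/-- **Equidistribution of an abelian Frobenius datum from `L(1, χ) ≠ 0` alone.**  Let `𝔪 ≠ 0`, `G`
a finite abelian group and `f` a map from the primes of `K` to `G` whose multiplicative extension
kills the ray `mod 𝔪` (`ArtinKillsRay`) and such that every non-trivial character `χ` of `G` is
`≠ 1` at some `f 𝔭`, `𝔭 ∤ 𝔪`. Then EVERY fibre `{𝔭 ∤ 𝔪 : f 𝔭 = τ}` has strong Dirichlet density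
`1/|G|`. This is Landau's orthogonality argument (`|G| · #{f 𝔭 = τ, N𝔭 = p} = ∑_χ χ(τ)⁻¹ F_χ(p)`;
the principal character contributes `−log (s − 1) + O(1)`, every other one a convergent `D_χ(s)` by
Hecke–Landau); it discharges the density hypothesis (iii) of the tree's conditional
`AbelianDensity.hasStrongDirichletDensity_frobFiber_of_forall_addChar` in general.
[cite: Landau1918Idealklassen, §1 Satz] -/
theorem hasStrongDirichletDensity_frobFiber_of_artinKillsRay (h𝔪 : 𝔪 ≠ ⊥) (hray : ArtinKillsRay 𝔪 f)
    (hsep : ∀ χ : AddChar (Additive G) ℂ, χ ≠ 0 →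
      ∃ v : HeightOneSpectrum (𝓞 K), ¬ 𝔪 ≤ v.asIdeal ∧ χ (Additive.ofMul (f v)) ≠ 1)
    (τ : G) :
    HasStrongDirichletDensity K (frobFiber 𝔪 f τ) (1 / Nat.card G) := by
  set D : AddChar (Additive G) ℂ → ℝ → ℂ := fun χ s ↦ ∑' v, primeTerm (charCoeff 𝔪 f χ) s v
    with hD
  have ha : ∀ (χ : AddChar (Additive G) ℂ) v, ‖charCoeff 𝔪 f χ v‖ ≤ 1 :=
    fun χ v ↦ norm_charCoeff_le 𝔪 f χ v
  have hcard0 : (Nat.card G : ℝ) ≠ 0 := Nat.cast_ne_zero.mpr Nat.card_pos.ne'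
  have hcard0' : (Nat.card G : ℂ) ≠ 0 := Nat.cast_ne_zero.mpr Nat.card_pos.ne'
  -- the weights `w χ = χ(τ)⁻¹`, with `w 0 = 1`
  set w : AddChar (Additive G) ℂ → ℂ := fun χ ↦ (χ (Additive.ofMul τ))⁻¹ with hw
  have hw0 : w 0 = 1 := by simp [hw]
  -- the real prime series of the fibre, as a complex `HasSum`
  set cnt : ℕ → ℝ := fun p ↦ (primeNormCount K (frobFiber 𝔪 f τ) p : ℝ) with hcnt
  have hcntB : ∀ p : Nat.Primes, |cnt p| ≤ (2 : ℝ) ^ Module.finrank ℚ K := fun p ↦ abs_primeNormCount_le _ p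
  have hreal : ∀ s : ℝ, 1 < s → HasSum (fun p : Nat.Primes ↦ ((cnt p * ((p : ℕ) : ℝ) ^ (-s) : ℝ) : ℂ))
      ((primeSeries cnt s : ℝ) : ℂ) := by
    intro s hs
    rw [primeSeries]
    exact Complex.hasSum_ofReal.mpr ((summable_primes_mul_rpow_of_bounded hcntB hs).hasSum)
  -- orthogonality: `∑_χ χ(τ)⁻¹ D_χ(s) = |G| · primeSeries cnt s`
  have hcomb : ∀ s : ℝ, 1 < s → ∑ χ, w χ * D χ s = (Nat.card G : ℂ) * ((primeSeries cnt s : ℝ) : ℂ) := by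
    intro s hs
    have h1 : HasSum (fun p : Nat.Primes ↦ ∑ χ : AddChar (Additive G) ℂ,
        w χ * (charCount 𝔪 f χ p * ((((p : ℕ) : ℝ) ^ (-s) : ℝ) : ℂ))) (∑ χ, w χ * D χ s) :=
      hasSum_sum fun (χ : AddChar (Additive G) ℂ) _ ↦ (hasSum_primeTerm_fiberwise (ha χ) hs).mul_left _
    have h2 : ∀ p : Nat.Primes, ∑ χ : AddChar (Additive G) ℂ,
        w χ * (charCount 𝔪 f χ p * ((((p : ℕ) : ℝ) ^ (-s) : ℝ) : ℂ)) =
          (Nat.card G : ℂ) * ((cnt p * ((p : ℕ) : ℝ) ^ (-s) : ℝ) : ℂ) := by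
      intro p
      have h := card_mul_primeNormCount (𝔪 := 𝔪) (f := f) τ p
      have h' : ∀ χ : AddChar (Additive G) ℂ,
          w χ * (charCount 𝔪 f χ p * ((((p : ℕ) : ℝ) ^ (-s) : ℝ) : ℂ)) =
            (w χ * charCount 𝔪 f χ p) * ((((p : ℕ) : ℝ) ^ (-s) : ℝ) : ℂ) := fun χ ↦ by ring
      simp only [h']
      rw [← Finset.sum_mul, ← h, hcnt]
      push_cast
      ring
    simp only [h2] at h1
    exact h1.unique ((hreal s hs).mul_left _)
  -- the limits of the `D_χ`
  obtain ⟨L₀, hL₀⟩ := tendsto_charPrimeSum_zero_add_log (K := K) h𝔪 f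
  set S : Finset (AddChar (Additive G) ℂ) := Finset.univ.erase 0 with hS
  have hdlim : ∀ χ ∈ S, ∃ d : ℂ, Tendsto (D χ) (𝓝[>] 1) (𝓝 d) := fun χ hχ ↦
    tendsto_charPrimeSum_of_artinKillsRay h𝔪 hray χ (hsep χ (Finset.ne_of_mem_erase hχ))
  choose! d hd using hdlim
  have hsplit_sum : ∀ F : AddChar (Additive G) ℂ → ℂ, ∑ χ, F χ = F 0 + ∑ χ ∈ S, F χ := fun F ↦
    (Finset.add_sum_erase Finset.univ F (Finset.mem_univ 0)).symm
  have hT : Tendsto (fun s : ℝ ↦ ∑ χ, w χ * D χ s + (Real.log (s - 1) : ℂ)) (𝓝[>] 1)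
      (𝓝 ((L₀ : ℂ) + ∑ χ ∈ S, w χ * d χ)) := by
    have h := hL₀.add (tendsto_finsetSum S fun χ hχ ↦ (hd χ hχ).const_mul (w χ))
    refine h.congr' ?_
    filter_upwards with s
    rw [hsplit_sum (fun χ ↦ w χ * D χ s), hw0, one_mul]
    ring
  -- conclusion: the real prime series of the fibre
  refine ⟨((1 / (Nat.card G : ℂ)) * ((L₀ : ℂ) + ∑ χ ∈ S, w χ * d χ)).re, ?_⟩
  have hre := (Complex.continuous_re.tendsto _).comp (hT.const_mul (1 / (Nat.card G : ℂ)))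
  refine hre.congr' ?_
  filter_upwards [self_mem_nhdsWithin] with s hs
  simp only [Function.comp_apply]
  have h3 : ((primeSeries cnt s : ℝ) : ℂ) = (1 / (Nat.card G : ℂ)) * ∑ χ, w χ * D χ s := by
    rw [hcomb s hs, ← mul_assoc, one_div_mul_cancel hcard0', one_mul]
  have h4 : (1 / (Nat.card G : ℂ)) * (∑ χ, w χ * D χ s + (Real.log (s - 1) : ℂ)) =
      (((primeSeries cnt s + 1 / (Nat.card G : ℝ) * Real.log (s - 1) : ℝ)) : ℂ) := by
    rw [mul_add, ← h3]
    push_cast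
    ring
  rw [h4, Complex.ofReal_re]

/-- **The tree's conditional equidistribution theorem made unconditional**: under the hypotheses of
`hasStrongDirichletDensity_frobFiber_of_artinKillsRay`, the density hypothesis (iii) of
`AbelianDensity.hasStrongDirichletDensity_frobFiber_of_forall_addChar` (the trivial fibre has density
`1/|G|`) holds. [cite: Landau1918Idealklassen, §1 Satz] -/
theorem hasStrongDirichletDensity_frobFiber_one_of_artinKillsRay (h𝔪 : 𝔪 ≠ ⊥) (hray : ArtinKillsRay 𝔪 f)
    (hsep : ∀ χ : AddChar (Additive G) ℂ, χ ≠ 0 →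
      ∃ v : HeightOneSpectrum (𝓞 K), ¬ 𝔪 ≤ v.asIdeal ∧ χ (Additive.ofMul (f v)) ≠ 1) :
    HasStrongDirichletDensity K (frobFiber 𝔪 f 1) (1 / Nat.card G) :=
  hasStrongDirichletDensity_frobFiber_of_artinKillsRay h𝔪 hray hsep 1

end Generic

/-! ### Landau's theorem: every narrow ray class has Dirichlet density `1/h_𝔪` -/

/-- **Landau's theorem: every narrow ray class `mod 𝔪` has strong Dirichlet density `1/h_𝔪`**
(Landau 1918, §1, from `L(1, χ) ≠ 0`; Neukirch VII (13.2) for the ray class field): for every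
`τ ∈ Cl_K^𝔪`, `∑_{deg 𝔭 = 1, 𝔭 ∤ 𝔪, [𝔭] = τ} N𝔭^{-s} + (1/h_𝔪) log (s − 1)` converges as `s → 1⁺`.
[cite: Landau1918Idealklassen, §1 Satz] -/
theorem hasStrongDirichletDensity_rayClassFiber (h𝔪 : 𝔪 ≠ ⊥) (τ : RayClassGroup 𝔪) :
    HasStrongDirichletDensity K (frobFiber 𝔪 (primeRayClass 𝔪 h𝔪) τ)
      (1 / Nat.card (RayClassGroup 𝔪)) := by
  haveI : Finite (RayClassGroup 𝔪) := finite_rayClassGroup h𝔪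
  exact hasStrongDirichletDensity_frobFiber_of_artinKillsRay h𝔪 (artinKillsRay_primeRayClass h𝔪)
    (fun χ hχ ↦ exists_charFun_primeRayClass_ne_one h𝔪 χ hχ) τ

/-- Membership in a fibre of the class datum: `𝔭 ∤ 𝔪` and `[𝔭] = τ`. [folklore] -/
theorem mem_frobFiber_primeRayClass (h𝔪 : 𝔪 ≠ ⊥) {τ : RayClassGroup 𝔪} {v : HeightOneSpectrum (𝓞 K)} :
    v ∈ frobFiber 𝔪 (primeRayClass 𝔪 h𝔪) τ ↔ ¬ 𝔪 ≤ v.asIdeal ∧ primeRayClass 𝔪 h𝔪 v = τ :=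
  mem_frobFiber 𝔪 _

/-- **The primes in the narrow ray class of `𝔟`.** For a nonzero integral ideal `𝔟` prime to `𝔪`,
the primes `𝔭 ∤ 𝔪` with `RayClassRel 𝔪 𝔟 𝔭` (`(c) 𝔭 = (b) 𝔟` with `b ≡ c mod 𝔪`, `c` prime to
`𝔪`, `b/c` totally positive) are exactly the fibre of the class of `𝔟`. [cite: NeukirchANT1999, Ch. VI §1 Prop. (1.9)] -/
theorem setOf_rayClassRel_eq_frobFiber (h𝔪 : 𝔪 ≠ ⊥) (𝔟 : CoprimeIdeal 𝔪) :
    {v : HeightOneSpectrum (𝓞 K) | ¬ 𝔪 ≤ v.asIdeal ∧ RayClassRel 𝔪 𝔟.1 v.asIdeal} =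
      frobFiber 𝔪 (primeRayClass 𝔪 h𝔪) (integralRayClass 𝔪 h𝔪 𝔟) := by
  ext v
  rw [mem_frobFiber_primeRayClass h𝔪, Set.mem_setOf_eq]
  refine and_congr_right fun hv ↦ ?_
  rw [primeRayClass_of_not_le h𝔪 hv ⟨v.ne_bot, isCoprime_asIdeal_of_not_le h𝔪 hv⟩,
    integralRayClass_eq_iff h𝔪]
  exact ⟨fun h ↦ h.symm, fun h ↦ h.symm⟩

/-- **Landau's theorem in `RayClassRel` form**: for `𝔪 ≠ 0` and a nonzero integral ideal `𝔟` prime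
to `𝔪`, the set of primes `𝔭 ∤ 𝔪` in the narrow ray class of `𝔟` `mod 𝔪` has strong Dirichlet
density `1/h_𝔪`, `h_𝔪 = #Cl_K^𝔪`. [cite: Landau1918Idealklassen, §1 Satz] -/
theorem hasStrongDirichletDensity_rayClassRel (h𝔪 : 𝔪 ≠ ⊥) (𝔟 : CoprimeIdeal 𝔪) :
    HasStrongDirichletDensity K {v | ¬ 𝔪 ≤ v.asIdeal ∧ RayClassRel 𝔪 𝔟.1 v.asIdeal}
      (1 / Nat.card (RayClassGroup 𝔪)) := by
  rw [setOf_rayClassRel_eq_frobFiber h𝔪 𝔟]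
  exact hasStrongDirichletDensity_rayClassFiber h𝔪 _

/-! ### Infinitely many primes of degree one in every class -/

/-- **Every narrow ray class contains infinitely many prime ideals of degree one** (Landau 1918;
the "generalized theorem about the existence of prime ideals in arithmetic progressions" invoked by
Cassels 1964, p. 70): for `𝔪 ≠ 0` and `𝔟` a nonzero integral ideal prime to `𝔪` there are
infinitely many primes `𝔭 ∤ 𝔪` of prime absolute norm with `RayClassRel 𝔪 𝔟 𝔭`, i.e.
`(c) 𝔭 = (b) 𝔟` for some nonzero `b, c ∈ 𝓞 K` with `c` prime to `𝔪`, `b ≡ c mod 𝔪` and `b/c`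
totally positive. [cite: Landau1918Idealklassen, §1 Satz] -/
theorem infinite_setOf_rayClassRel_and_prime_absNorm (h𝔪 : 𝔪 ≠ ⊥) (𝔟 : CoprimeIdeal 𝔪) :
    {v : HeightOneSpectrum (𝓞 K) | (¬ 𝔪 ≤ v.asIdeal ∧ RayClassRel 𝔪 𝔟.1 v.asIdeal) ∧
      (Ideal.absNorm v.asIdeal).Prime}.Infinite := by
  haveI : Finite (RayClassGroup 𝔪) := finite_rayClassGroup h𝔪
  have hc : (0 : ℝ) < 1 / Nat.card (RayClassGroup 𝔪) := by
    have : (0 : ℝ) < Nat.card (RayClassGroup 𝔪) := Nat.cast_pos.mpr Nat.card_pos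
    positivity
  exact (hasStrongDirichletDensity_rayClassRel h𝔪 𝔟).infinite_setOf_prime_absNorm hc

/-- **Degree-one primes in a narrow ray class, avoiding any finite set** (the working form: Cassels
1964, p. 70, needs the prime ideal distinct from finitely many given ones). [cite: Landau1918Idealklassen, §1 Satz] -/
theorem exists_rayClassRel_prime_absNorm_not_mem (h𝔪 : 𝔪 ≠ ⊥) (𝔟 : CoprimeIdeal 𝔪)
    (S : Set (HeightOneSpectrum (𝓞 K))) (hS : S.Finite) :
    ∃ v : HeightOneSpectrum (𝓞 K), v ∉ S ∧ ¬ 𝔪 ≤ v.asIdeal ∧ RayClassRel 𝔪 𝔟.1 v.asIdeal ∧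
      (Ideal.absNorm v.asIdeal).Prime := by
  obtain ⟨v, ⟨⟨hv, hrel⟩, hp⟩, hvS⟩ := ((infinite_setOf_rayClassRel_and_prime_absNorm h𝔪 𝔟).sdiff hS).nonempty
  exact ⟨v, hvS, hv, hrel, hp⟩

end Literature.NumberTheory.LFunctions
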